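import Mathlib
import HarnessLib

/-!
# Crux `HeckeEigenvalueField` — line `Sketch`, (c') programme: the abstract adjoint argument in degree
# `m + 1`, two-space form (the primitive and its derivatives live in different spaces)

Namespace `Summit.Langlands.Langlands.Theorems.HeckeEigenvalueField.Res`.  Pure linear algebra
(theorems only, no definition): the variant of the landed `stub_mem_range_of_pairedPrimitive`
(`…StubAdjoint.lean`) in which `Lop' : ιb → H'' → H'` maps a space `H''` (functions with one controlled
derivative) to a space `H'` (continuous functions), each paired against `H` (`B''`, `B`); the proof is the
same finite-dimensional orthogonal-projection argument.
-/

set_option linter.dupNamespace false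

noncomputable section

open scoped ComplexConjugate BigOperators
open Finset

namespace Summit.Langlands.Langlands.Theorems.HeckeEigenvalueField.Res

/-- **The abstract adjoint argument in degree `m + 1`, two-space form** (the primitive `u` lives in a
space `H''` of `C¹` data, its derivatives `Lop' b u` in a space `H'` of continuous data, each with its own
pairing against `H`; otherwise as `stub_mem_range_of_pairedPrimitive`): in a finite-dimensional
subspace `Z` of tuple cochains stable under `D D*`, a cochain `η ∈ Z` whose functional `ip η ·` is
represented through the pairing `B` by a `D'`-coboundary `D' u` (with `B (L' u) v = B u (L* v)`) lies in
`D(T)`.  Proof: `θ := η - proj_{D T} η ⊥ D T`, so `D* θ = 0` (as `D D* θ ∈ D T`), so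
`⟨η, θ⟩ = B(D'u, θ) = B(u, D*θ) = 0`, so `θ ⊥ θ`.
[cite: BorelWallach2000, II §2] [cite: Borel1981StableRealII, Thm. 5.2] [folklore] -/
theorem stub_mem_range_of_pairedPrimitive_two
    {ιb : Type} [Fintype ιb] {H H' H'' : Type} [AddCommGroup H] [Module ℂ H] [AddCommGroup H'] [Module ℂ H']
    [AddCommGroup H''] [Module ℂ H'']
    (ip : H → H → ℂ) (hip_add : ∀ u v w, ip (u + v) w = ip u w + ip v w)
    (hip_smul : ∀ (z : ℂ) v w, ip (z • v) w = z * ip v w)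
    (hip_symm : ∀ v w, ip v w = (starRingEnd ℂ) (ip w v)) (hip_pos : ∀ v, v ≠ 0 → 0 < (ip v v).re)
    (B : H' → H → ℂ) (hB_add : ∀ u v w, B u (v + w) = B u v + B u w)
    (hB_add_left : ∀ u u' v, B (u + u') v = B u v + B u' v)
    (hB_smul_left : ∀ (z : ℂ) u v, B (z • u) v = z * B u v)
    (B'' : H'' → H → ℂ) (hB''_add : ∀ u v w, B'' u (v + w) = B'' u v + B'' u w)
    (Lop Ladj : ιb → H →ₗ[ℂ] H) (hLadj : ∀ b u v, ip (Lop b u) v = ip u (Ladj b v))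
    (Lop' : ιb → H'' → H') (hL' : ∀ b u v, B (Lop' b u) v = B'' u (Ladj b v))
    {m : ℕ} (Z : Submodule ℂ ((Fin (m + 1) → ιb) → H)) [FiniteDimensional ℂ Z]
    (T : Submodule ℂ ((Fin m → ιb) → H))
    (hDT : ∀ τ ∈ T, (fun I : Fin (m + 1) → ιb =>
      ∑ i : Fin (m + 1), ((-1 : ℂ) ^ (i : ℕ)) • Lop (I i) (τ fun j => I (i.succAbove j))) ∈ Z)
    (hDadjZ : ∀ θ ∈ Z, (fun J : Fin m → ιb =>
      ∑ i : Fin (m + 1), ∑ b : ιb, ((-1 : ℂ) ^ (i : ℕ)) • Ladj b (θ (Fin.insertNth i b J))) ∈ T)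
    (η : (Fin (m + 1) → ιb) → H) (hη : η ∈ Z) (u : (Fin m → ιb) → H'')
    (hprim : ∀ (I : Fin (m + 1) → ιb) (v : H), ip (η I) v =
      B (∑ i : Fin (m + 1), ((-1 : ℂ) ^ (i : ℕ)) • Lop' (I i) (u fun j => I (i.succAbove j))) v) :
    ∃ τ ∈ T, (fun I : Fin (m + 1) → ιb =>
      ∑ i : Fin (m + 1), ((-1 : ℂ) ^ (i : ℕ)) • Lop (I i) (τ fun j => I (i.succAbove j))) = η := by
  classical
  -- reindexing a sum over `(m+1)`-tuples along the `i`-th coordinate (`Fin.insertNthEquiv`)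
  have sum_tuple_eq_sum_insertNth' : ∀ {α : Type} [AddCommMonoid α] (i : Fin (m + 1))
      (F : ιb → (Fin m → ιb) → (Fin (m + 1) → ιb) → α),
      ∑ I : Fin (m + 1) → ιb, F (I i) (fun j => I (i.succAbove j)) I =
        ∑ b : ιb, ∑ J : Fin m → ιb, F b J (Fin.insertNth i b J) := by
    intro α _ i F
    rw [← Fintype.sum_prod_type']
    refine (Fintype.sum_equiv (Fin.insertNthEquiv (fun _ => ιb) i) _ _ fun x => ?_).symm
    simp [Fin.insertNthEquiv]
  -- basic consequences of the axioms on `ip` and `B`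
  have hip_zero_left : ∀ w, ip 0 w = 0 := fun w => by
    have h := hip_add 0 0 w
    rw [add_zero] at h
    have : ip 0 w + ip 0 w = ip 0 w + 0 := by rw [add_zero]; exact h.symm
    exact add_left_cancel this
  have hip_add_right : ∀ u v w, ip u (v + w) = ip u v + ip u w := fun u v w => by
    rw [hip_symm, hip_add, map_add, ← hip_symm, ← hip_symm]
  have hip_smul_right : ∀ (z : ℂ) u v, ip u (z • v) = conj z * ip u v := fun z u v => by
    rw [hip_symm, hip_smul, map_mul, ← hip_symm]
  have hip_sign_right : ∀ (i : ℕ) u v, ip u (((-1 : ℂ) ^ i) • v) = ((-1 : ℂ) ^ i) * ip u v := by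
    intro i u v
    rw [hip_smul_right, map_pow, map_neg, map_one]
  have hip_sum_left : ∀ (σ : Type) (s : Finset σ) (f : σ → H) (w : H),
      ip (∑ i ∈ s, f i) w = ∑ i ∈ s, ip (f i) w := by
    intro σ s f w
    induction s using Finset.induction_on with
    | empty => rw [sum_empty, sum_empty, hip_zero_left]
    | insert a s ha ih => rw [sum_insert ha, sum_insert ha, hip_add, ih]
  have hip_sum_right : ∀ (σ : Type) (s : Finset σ) (u : H) (f : σ → H),
      ip u (∑ i ∈ s, f i) = ∑ i ∈ s, ip u (f i) := by
    intro σ s u f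
    rw [hip_symm, hip_sum_left, map_sum]
    exact sum_congr rfl fun i _ => (hip_symm _ _).symm
  have hB_zero_right : ∀ u', B u' 0 = 0 := fun u' => by
    have h := hB_add u' 0 0
    rw [add_zero] at h
    have : B u' 0 + B u' 0 = B u' 0 + 0 := by rw [add_zero]; exact h.symm
    exact add_left_cancel this
  have hB_neg_right : ∀ u' v, B u' (-v) = -B u' v := fun u' v => by
    have h := hB_add u' v (-v)
    rw [add_neg_cancel, hB_zero_right] at h
    exact (neg_eq_of_add_eq_zero_right h.symm).symm
  have hB_sign_right : ∀ (i : ℕ) u' v, B u' (((-1 : ℂ) ^ i) • v) = ((-1 : ℂ) ^ i) * B u' v := by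
    intro i u' v
    rcases neg_one_pow_eq_or ℂ i with h | h
    · rw [h, one_smul, one_mul]
    · rw [h, neg_one_smul, hB_neg_right, neg_one_mul]
  have hB_sum_right : ∀ (σ : Type) (s : Finset σ) (u' : H') (f : σ → H),
      B u' (∑ i ∈ s, f i) = ∑ i ∈ s, B u' (f i) := by
    intro σ s u' f
    induction s using Finset.induction_on with
    | empty => rw [sum_empty, sum_empty, hB_zero_right]
    | insert a s ha ih => rw [sum_insert ha, sum_insert ha, hB_add, ih]
  have hB_zero_left : ∀ v, B 0 v = 0 := fun v => by
    have h := hB_add_left 0 0 v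
    rw [add_zero] at h
    have : B 0 v + B 0 v = B 0 v + 0 := by rw [add_zero]; exact h.symm
    exact add_left_cancel this
  have hB_sum_left : ∀ (σ : Type) (s : Finset σ) (f : σ → H') (v : H),
      B (∑ i ∈ s, f i) v = ∑ i ∈ s, B (f i) v := by
    intro σ s f v
    induction s using Finset.induction_on with
    | empty => rw [sum_empty, sum_empty, hB_zero_left]
    | insert a s ha ih => rw [sum_insert ha, sum_insert ha, hB_add_left, ih]
  have hB''_zero_right : ∀ u', B'' u' 0 = 0 := fun u' => by
    have h := hB''_add u' 0 0
    rw [add_zero] at h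
    have : B'' u' 0 + B'' u' 0 = B'' u' 0 + 0 := by rw [add_zero]; exact h.symm
    exact add_left_cancel this
  have hB''_neg_right : ∀ u' v, B'' u' (-v) = -B'' u' v := fun u' v => by
    have h := hB''_add u' v (-v)
    rw [add_neg_cancel, hB''_zero_right] at h
    exact (neg_eq_of_add_eq_zero_right h.symm).symm
  have hB''_sign_right : ∀ (i : ℕ) u' v, B'' u' (((-1 : ℂ) ^ i) • v) = ((-1 : ℂ) ^ i) * B'' u' v := by
    intro i u' v
    rcases neg_one_pow_eq_or ℂ i with h | h
    · rw [h, one_smul, one_mul]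
    · rw [h, neg_one_smul, hB''_neg_right, neg_one_mul]
  have hB''_sum_right : ∀ (σ : Type) (s : Finset σ) (u' : H'') (f : σ → H),
      B'' u' (∑ i ∈ s, f i) = ∑ i ∈ s, B'' u' (f i) := by
    intro σ s u' f
    induction s using Finset.induction_on with
    | empty => rw [sum_empty, sum_empty, hB''_zero_right]
    | insert a s ha ih => rw [sum_insert ha, sum_insert ha, hB''_add, ih]
  -- notation: `D`, `D*`, and the two hermitian forms on tuple cochains
  let D : ((Fin m → ιb) → H) →ₗ[ℂ] ((Fin (m + 1) → ιb) → H) :=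
    { toFun := fun τ I => ∑ i : Fin (m + 1), ((-1 : ℂ) ^ (i : ℕ)) • Lop (I i) (τ fun j => I (i.succAbove j))
      map_add' := fun τ τ' => by
        funext I
        simp only [Pi.add_apply, map_add, smul_add, sum_add_distrib]
      map_smul' := fun z τ => by
        funext I
        simp only [Pi.smul_apply, map_smul, RingHom.id_apply, smul_sum, smul_comm z] }
  let Dadj : ((Fin (m + 1) → ιb) → H) → ((Fin m → ιb) → H) := fun θ J =>
    ∑ i : Fin (m + 1), ∑ b : ιb, ((-1 : ℂ) ^ (i : ℕ)) • Ladj b (θ (Fin.insertNth i b J))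
  let IP : ((Fin (m + 1) → ιb) → H) → ((Fin (m + 1) → ιb) → H) → ℂ :=
    fun θ θ' => ∑ I, ip (θ I) (θ' I)
  let IPm : ((Fin m → ιb) → H) → ((Fin m → ιb) → H) → ℂ := fun τ τ' => ∑ J, ip (τ J) (τ' J)
  have hD_apply : ∀ τ I, D τ I =
      ∑ i : Fin (m + 1), ((-1 : ℂ) ^ (i : ℕ)) • Lop (I i) (τ fun j => I (i.succAbove j)) :=
    fun τ I => rfl
  have hDadj_apply : ∀ θ J, Dadj θ J =
      ∑ i : Fin (m + 1), ∑ b : ιb, ((-1 : ℂ) ^ (i : ℕ)) • Ladj b (θ (Fin.insertNth i b J)) :=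
    fun θ J => rfl
  have hIP_apply : ∀ θ θ', IP θ θ' = ∑ I, ip (θ I) (θ' I) := fun _ _ => rfl
  have hIPm_apply : ∀ τ τ', IPm τ τ' = ∑ J, ip (τ J) (τ' J) := fun _ _ => rfl
  -- (a) the adjunction `⟨⟨D τ, θ⟩⟩ = ⟨⟨τ, D* θ⟩⟩`
  have hadj : ∀ τ θ, IP (D τ) θ = IPm τ (Dadj θ) := by
    intro τ θ
    have lhs : IP (D τ) θ = ∑ i : Fin (m + 1), ∑ b : ιb, ∑ J : Fin m → ιb,
        ((-1 : ℂ) ^ (i : ℕ)) * ip (τ J) (Ladj b (θ (Fin.insertNth i b J))) := by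
      rw [hIP_apply]
      calc ∑ I, ip (D τ I) (θ I)
          = ∑ I : Fin (m + 1) → ιb, ∑ i : Fin (m + 1), ((-1 : ℂ) ^ (i : ℕ)) *
              ip (τ fun j => I (i.succAbove j)) (Ladj (I i) (θ I)) := by
            refine sum_congr rfl fun I _ => ?_
            rw [hD_apply, hip_sum_left]
            exact sum_congr rfl fun i _ => by rw [hip_smul, hLadj]
        _ = _ := by
            rw [sum_comm]
            exact sum_congr rfl fun i _ => sum_tuple_eq_sum_insertNth' i
              (fun b J I => ((-1 : ℂ) ^ (i : ℕ)) * ip (τ J) (Ladj b (θ I)))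
    have rhs : IPm τ (Dadj θ) = ∑ J : Fin m → ιb, ∑ i : Fin (m + 1), ∑ b : ιb,
        ((-1 : ℂ) ^ (i : ℕ)) * ip (τ J) (Ladj b (θ (Fin.insertNth i b J))) := by
      rw [hIPm_apply]
      refine sum_congr rfl fun J _ => ?_
      rw [hDadj_apply, hip_sum_right]
      refine sum_congr rfl fun i _ => ?_
      rw [hip_sum_right]
      exact sum_congr rfl fun b _ => hip_sign_right _ _ _
    rw [lhs, rhs]
    conv_rhs => rw [sum_comm]
    exact sum_congr rfl fun i _ => sum_comm
  -- (b) the adjunction read through `B`, `B''`: `B(D' u, θ) = B''(u, D* θ)`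
  have hadjB : ∀ θ : (Fin (m + 1) → ιb) → H,
      ∑ I, B (∑ i : Fin (m + 1), ((-1 : ℂ) ^ (i : ℕ)) • Lop' (I i) (u fun j => I (i.succAbove j)))
        (θ I) = ∑ J, B'' (u J) (Dadj θ J) := by
    intro θ
    have lhs : ∑ I, B (∑ i : Fin (m + 1), ((-1 : ℂ) ^ (i : ℕ)) •
        Lop' (I i) (u fun j => I (i.succAbove j))) (θ I) = ∑ i : Fin (m + 1), ∑ b : ιb,
          ∑ J : Fin m → ιb, ((-1 : ℂ) ^ (i : ℕ)) * B'' (u J) (Ladj b (θ (Fin.insertNth i b J))) := by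
      calc ∑ I, B (∑ i : Fin (m + 1), ((-1 : ℂ) ^ (i : ℕ)) •
              Lop' (I i) (u fun j => I (i.succAbove j))) (θ I)
          = ∑ I : Fin (m + 1) → ιb, ∑ i : Fin (m + 1), ((-1 : ℂ) ^ (i : ℕ)) *
              B'' (u fun j => I (i.succAbove j)) (Ladj (I i) (θ I)) := by
            refine sum_congr rfl fun I _ => ?_
            rw [hB_sum_left]
            exact sum_congr rfl fun i _ => by rw [hB_smul_left, hL']
        _ = _ := by
            rw [sum_comm]
            exact sum_congr rfl fun i _ => sum_tuple_eq_sum_insertNth' i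
              (fun b J I => ((-1 : ℂ) ^ (i : ℕ)) * B'' (u J) (Ladj b (θ I)))
    have rhs : ∑ J, B'' (u J) (Dadj θ J) = ∑ J : Fin m → ιb, ∑ i : Fin (m + 1), ∑ b : ιb,
        ((-1 : ℂ) ^ (i : ℕ)) * B'' (u J) (Ladj b (θ (Fin.insertNth i b J))) := by
      refine sum_congr rfl fun J _ => ?_
      rw [hDadj_apply, hB''_sum_right]
      refine sum_congr rfl fun i _ => ?_
      rw [hB''_sum_right]
      exact sum_congr rfl fun b _ => hB''_sign_right _ _ _
    rw [lhs, rhs]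
    conv_rhs => rw [sum_comm]
    exact sum_congr rfl fun i _ => sum_comm
  -- positivity
  have hsum_re_nonneg : ∀ {σ : Type} [Fintype σ] (θ : σ → H), 0 ≤ (∑ I, ip (θ I) (θ I)).re := by
    intro σ _ θ
    rw [Complex.re_sum]
    exact sum_nonneg fun I _ => by
      by_cases h : θ I = 0
      · rw [h, hip_zero_left, Complex.zero_re]
      · exact (hip_pos _ h).le
  have hsum_eq_zero : ∀ {σ : Type} [Fintype σ] (θ : σ → H), ∑ I, ip (θ I) (θ I) = 0 → θ = 0 := by
    intro σ _ θ hθ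
    funext I
    by_contra hI
    have hpos : 0 < (∑ I, ip (θ I) (θ I)).re := by
      rw [Complex.re_sum]
      refine sum_pos' (fun I' _ => ?_) ⟨I, mem_univ _, hip_pos _ hI⟩
      by_cases h : θ I' = 0
      · rw [h, hip_zero_left, Complex.zero_re]
      · exact (hip_pos _ h).le
    rw [hθ, Complex.zero_re] at hpos
    exact lt_irrefl _ hpos
  -- the inner product space structure on `Z` (Mathlib convention: conjugate-linear in the first slot)
  have hIP_add_right : ∀ θ ξ ξ', IP θ (ξ + ξ') = IP θ ξ + IP θ ξ' := fun θ ξ ξ' => by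
    simp only [hIP_apply, Pi.add_apply, hip_add_right, sum_add_distrib]
  have hIP_smul_right : ∀ (z : ℂ) θ ξ, IP θ (z • ξ) = conj z * IP θ ξ := fun z θ ξ => by
    simp only [hIP_apply, Pi.smul_apply, hip_smul_right, mul_sum]
  have hIP_symm : ∀ θ ξ, IP θ ξ = conj (IP ξ θ) := fun θ ξ => by
    simp only [hIP_apply, map_sum]
    exact sum_congr rfl fun I _ => hip_symm _ _
  let core : InnerProductSpace.Core ℂ Z :=
    { inner := fun x y => IP (y : (Fin (m + 1) → ιb) → H) (x : (Fin (m + 1) → ιb) → H)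
      conj_inner_symm := fun x y => (hIP_symm _ _).symm
      re_inner_nonneg := fun x => hsum_re_nonneg _
      add_left := fun x y z => hIP_add_right _ _ _
      smul_left := fun x y r => hIP_smul_right _ _ _
      definite := fun x hx => by
        have h0 : ((x : (Fin (m + 1) → ιb) → H)) = 0 := hsum_eq_zero _ hx
        exact_mod_cast h0 }
  letI : NormedAddCommGroup Z := @InnerProductSpace.Core.toNormedAddCommGroup ℂ Z _ _ _ core
  letI : InnerProductSpace ℂ Z := InnerProductSpace.ofCore _
  have hinner : ∀ x y : Z, (inner ℂ x y : ℂ) =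
      IP (y : (Fin (m + 1) → ιb) → H) (x : (Fin (m + 1) → ιb) → H) := fun x y => rfl
  -- the coboundaries inside `Z`
  let R : Submodule ℂ Z := (T.map D).comap Z.subtype
  let ζ : Z := ⟨η, hη⟩
  let θ : Z := ζ - R.starProjection ζ
  have hθorth : θ ∈ Rᗮ := Submodule.sub_starProjection_mem_orthogonal ζ
  -- `D* θ = 0`: `D* θ ∈ T` and `⟨⟨D* θ, D* θ⟩⟩ = ⟨⟨D D* θ, θ⟩⟩ = 0`
  have hDadjT : Dadj (θ : (Fin (m + 1) → ιb) → H) ∈ T := hDadjZ _ θ.2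
  have hDadj0 : Dadj (θ : (Fin (m + 1) → ιb) → H) = 0 := by
    apply hsum_eq_zero
    have hmem : (⟨D (Dadj (θ : (Fin (m + 1) → ιb) → H)), hDT _ hDadjT⟩ : Z) ∈ R :=
      Submodule.mem_map_of_mem hDadjT
    have h0 := (Submodule.mem_orthogonal R θ).1 hθorth _ hmem
    rw [hinner] at h0
    have h0' : IP (θ : (Fin (m + 1) → ιb) → H) (D (Dadj (θ : (Fin (m + 1) → ιb) → H))) = 0 := h0
    rw [← hIPm_apply, ← hadj, hIP_symm, h0', map_zero]
  -- `⟨⟨η, θ⟩⟩ = B(D' u, θ) = B(u, D* θ) = 0`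
  have hIPηθ : IP η (θ : (Fin (m + 1) → ιb) → H) = 0 := by
    have h1 : IP η (θ : (Fin (m + 1) → ιb) → H) = ∑ I, B (∑ i : Fin (m + 1), ((-1 : ℂ) ^ (i : ℕ)) •
        Lop' (I i) (u fun j => I (i.succAbove j))) ((θ : (Fin (m + 1) → ιb) → H) I) := by
      rw [hIP_apply]
      exact sum_congr rfl fun I _ => hprim _ _
    rw [h1, hadjB, hDadj0]
    exact sum_eq_zero fun J _ => hB''_zero_right _
  -- hence `θ = 0`
  have hθ0 : θ = 0 := by
    have hproj : (inner ℂ (R.starProjection ζ) θ : ℂ) = 0 :=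
      (Submodule.mem_orthogonal R θ).1 hθorth _ (Submodule.starProjection_apply_mem R ζ)
    have hself : (inner ℂ θ θ : ℂ) = 0 := by
      have : (inner ℂ θ θ : ℂ) = inner ℂ ζ θ - inner ℂ (R.starProjection ζ) θ := by
        rw [← inner_sub_left]
      rw [this, hproj, sub_zero, hinner, hIP_symm]
      change conj (IP η _) = 0
      rw [hIPηθ, map_zero]
    exact inner_self_eq_zero.1 hself
  -- so `η = proj ζ ∈ R`, i.e. `η = D τ` with `τ ∈ T`
  have hζR : ζ ∈ R := by
    have : ζ = R.starProjection ζ := by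
      rw [← sub_eq_zero]
      exact hθ0
    rw [this]
    exact Submodule.starProjection_apply_mem R ζ
  obtain ⟨τ, hτT, hτ⟩ := Submodule.mem_map.1 hζR
  refine ⟨τ, hτT, ?_⟩
  funext I
  have : D τ = η := hτ
  rw [← this]
  exact (hD_apply τ I).symm

end Summit.Langlands.Langlands.Theorems.HeckeEigenvalueField.Res

end
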